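import Summits.ResolutionOfSingularities.ResolutionOfSingularities.Theorems.PurelyInseparableDim4LucasCeiling
import Summits.ResolutionOfSingularities.ResolutionOfSingularities.Theorems.PurelyInseparableDim4ResConePowerConeTilt
import Summits.ResolutionOfSingularities.ResolutionOfSingularities.Theorems.PurelyInseparableDim4ResConePowerConeWitness
import Summits.ResolutionOfSingularities.ResolutionOfSingularities.Theorems.PurelyInseparableDim4SwapTransportReadOne
import Summits.ResolutionOfSingularities.ResolutionOfSingularities.Theorems.PurelyInseparableDim4ResConeShadeOneStep
import HarnessLib
import HarnessLib.Audit.Tags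

/-!
# Purely inseparable four-folds — HEAVY-LETTER SLICES: along an untranslated non-chart letter `z` the `x_z^e`-slices of `F` never mix
# under a point step and are never cleaned for `q ∤ e`; the bottom slice of a power-cone state (cell `res-dim4-pi`, K2(p) lane, B rows,
# B-LOSSY tool-box — the COEFFICIENT form of res-dim4-p-8 g7's slicing (S1)/(S2); seat res-dim4-p-1 g7)

[OURS · counted 0 · cell `res-dim4-pi` · K2(p) lane (holder res-dim4-p-12 g5, ruling g5-28 «kernel form of p-8's slicing (S1)/(S2)»).
The TEXT is res-dim4-p-8 g7's «HEAVY-LETTER SLICING» (bus 2026-08-29 14:20:34Z); its SUPPORT form is p-8's own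
`…ResConeUntranslatedLetterSlices` (`exists_source_apply_eq_of_untranslated`); this file is the COEFFICIENT form, over the res-dim4-p-10/p-13
lineage's Lucas expansion `LucasCeiling.coeff_pointTransform` (CITED BY NAME).]  Nothing here proves K2(p) for any `p`, any TAIL(p, d, e),
`NoAboveFloorTrap p p` or resolution of singularities in dimension ≥ 4 / characteristic `p` — NOT proved; bookkeeping of ONE step of OUR frame.
AI kernel work, weaker than expert review.

ONE POINT STEP `CentreBlowup.step q univ j b s` (chart `x_j`, point `b`, `b_j = 0`) and a letter `z ≠ j` that is NOT TRANSLATED (`b_z = 0`).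
Write `F = Σ_e x_z^e · F_e` (the `x_z`-SLICES).  Since the chart map keeps the `x_z`-exponent of every monomial (`z ≠ j`) and the translation
does not touch `x_z`, a parent monomial `x^E` only feeds child exponents `D` with `D_z = E_z`:
* §1 **`coeff_pointTransform_slice`** — `coeff_D` of the uncleaned child is the Lucas sum over the parent monomials of the SAME slice
  `E_z = D_z`, with the `z`-factor gone; **`coeff_pointTransform_eq_of_slice_eq`** — two parents with the same `x_z^e`-slice have uncleaned
  children with the same `x_z^e`-slice (SLICES NEVER MIX); **`coeff_step_F_of_not_dvd`** — on a slice `q ∤ e` the cleaning is the identity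
  (the slices `1 ≤ e ≤ q − 1` are NEVER CLEANED); `step_r_apply_of_ne_chart_of_untranslated` — the weight of `z` is kept.
* §2 THE BOTTOM SLICE OF A POWER-CONE STATE (p-8's (S2)): boundary `r` with `r_z = m`, `x^r ∣ F`, order `o = |r| + d`, residual cone
  `a·ℓ^d` with `ℓ_φ ≠ 0` for a letter `φ ≠ z`: **`coeff_bottomSlice_eq_coeff_killVar_pow`** — in degree `o` the slice `m` IS
  `x^r · a · (ℓ|_{x_z := 0})^d` (coefficientwise), **`coeff_bottomSlice_contact_ne_zero`** — its monomial `x^r·x_φ^d` has coefficient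
  `a·ℓ_φ^d ≠ 0` (so the trivariate residual `G = F_m / x^{r − m·e_z}` has order EXACTLY `|r| − m + d` and a power-cone initial form transversal
  to the `φ`-axis), and every slice-`m` monomial has degree `≥ o` (`le_degree_of_mem_support_of_ordZero`).  With §1 the child's bottom slice is
  the uncleaned transform of the parent's, with the same `m = r′_z` — p-8's trivariate game `G′ = σ_{j,b}(G)/x_j^{q−m}`.
The absorbing state `G = unit·φ′^d` of that game (bus 14:31:36Z) shows the B-LOSSY obstruction lives in the INTERACTION of slices, for which
§1 is the bookkeeping input; nothing here is a kill.
[cite: Hauser2010, §§F–G (chart expressions of a point blowup; cleaning)] [cite: HauserPerlega2019PRIMS, §2 (transform at a translated point)]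
bears_on: LADDER-RESOLUTION:D157-DOOR2 (res-dim4-pi · K2(p) B-LOSSY tool-box · heavy-letter slices, coefficient form).  Supports
stmt-ResolutionOfSingularities-16155 (helper).
-/

set_option linter.dupNamespace false -- mandated namespace of this single-conjunct summit

noncomputable section

namespace Summit.ResolutionOfSingularities.ResolutionOfSingularities.Theorems.PIDim4
namespace ResCone

open MvPolynomial Finset
open Literature.AlgebraicGeometry.Resolution
open Literature.AlgebraicGeometry.Resolution.CentreBlowup
open Literature.AlgebraicGeometry.Resolution.Hauser2010
open Literature.AlgebraicGeometry.Resolution.HauserPerlega2019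

variable {K : Type} [Field K] [DecidableEq K]

/-! ## §1 Slices along an untranslated non-chart letter never mix and are never cleaned -/

omit [DecidableEq K] in
/-- **THE SLICE FORM OF THE LUCAS EXPANSION**: for `z ≠ j` untranslated, `coeff_D` of the uncleaned child `translate b (chartTransform F)` is
the sum over the parent monomials `E` OF THE SAME `x_z`-SLICE (`E_z = D_z`) of `coeff_E F · ∏_{i ≠ z} C(e(E)_i, D_i)·b_i^{e(E)_i − D_i}`,
`e(E) = chartExponent q univ j E`. [OURS] [cite: HauserPerlega2019PRIMS, §2 (transform at a translated point)] -/
theorem coeff_pointTransform_slice (q : ℕ) (j : Fin 4) (b : Fin 4 → K) (s : State K) {z : Fin 4} (hzj : z ≠ j) (hbz : b z = 0)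
    (D : Fin 4 →₀ ℕ) :
    coeff D (CentreBlowup.pointTransform q Finset.univ j b s) =
      ∑ E ∈ s.F.support with E z = D z, coeff E s.F *
        ∏ i ∈ Finset.univ.erase z, (((chartExponent q Finset.univ j E i).choose (D i) : K) *
          b i ^ (chartExponent q Finset.univ j E i - D i)) := by
  rw [LucasCeiling.coeff_pointTransform, Finset.sum_filter]
  refine Finset.sum_congr rfl fun E _ => ?_
  rw [← Finset.mul_prod_erase _ _ (Finset.mem_univ z), LucasCeiling.factor_of_apply_eq_zero hbz,
    chartExponent_apply_of_ne q Finset.univ hzj]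
  by_cases h : E z = D z
  · rw [if_pos h.symm, one_mul, if_pos h]
  · rw [if_neg (Ne.symm h), zero_mul, mul_zero, if_neg h]

/-- **SLICES NEVER MIX**: two parents with the same `x_z^e`-slice (`z ≠ j`, `b_z = 0`) have uncleaned children with the same `x_z^e`-slice.
[OURS] [cite: Hauser2010, §F (chart expressions)] -/
theorem coeff_pointTransform_eq_of_slice_eq (q : ℕ) (j : Fin 4) (b : Fin 4 → K) {s t : State K} {z : Fin 4} (hzj : z ≠ j)
    (hbz : b z = 0) {e : ℕ} (hst : ∀ E : Fin 4 →₀ ℕ, E z = e → coeff E s.F = coeff E t.F) {D : Fin 4 →₀ ℕ} (hD : D z = e) :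
    coeff D (CentreBlowup.pointTransform q Finset.univ j b s) = coeff D (CentreBlowup.pointTransform q Finset.univ j b t) := by
  classical
  rw [coeff_pointTransform_slice q j b s hzj hbz, coeff_pointTransform_slice q j b t hzj hbz]
  -- both sums run over the slice `E_z = D_z`, where the coefficients agree; extend both to the union of the supports
  set Φ : (Fin 4 →₀ ℕ) → K := fun E => ∏ i ∈ Finset.univ.erase z,
    (((chartExponent q Finset.univ j E i).choose (D i) : K) * b i ^ (chartExponent q Finset.univ j E i - D i)) with hΦ
  have key : ∀ (u v : State K), (∀ E : Fin 4 →₀ ℕ, E z = e → coeff E u.F = coeff E v.F) →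
      ∑ E ∈ u.F.support with E z = D z, coeff E u.F * Φ E =
        ∑ E ∈ (u.F.support ∪ v.F.support) with E z = D z, coeff E u.F * Φ E := by
    intro u v _
    apply Finset.sum_subset
    · exact Finset.filter_subset_filter _ Finset.subset_union_left
    · intro E hE hEn
      rw [Finset.mem_filter] at hE hEn
      have hc : coeff E u.F = 0 := by
        by_contra hc
        exact hEn ⟨MvPolynomial.mem_support_iff.mpr hc, hE.2⟩
      rw [hc, zero_mul]
  rw [key s t hst, key t s (fun E hE => (hst E hE).symm), Finset.union_comm]
  refine Finset.sum_congr rfl fun E hE => ?_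
  rw [Finset.mem_filter] at hE
  rw [hst E (hE.2.trans hD)]

/-- **SLICES OFF THE `q`-LATTICE ARE NEVER CLEANED**: if `q ∤ D_z` the cleaned child has the same `coeff_D` as the uncleaned one. [OURS]
[cite: Hauser2010, §G (cleaning)] -/
theorem coeff_step_F_of_not_dvd (q : ℕ) (j : Fin 4) (b : Fin 4 → K) (s : State K) {z : Fin 4} {D : Fin 4 →₀ ℕ} (hD : ¬ q ∣ D z) :
    coeff D (CentreBlowup.step q Finset.univ j b s).F = coeff D (CentreBlowup.pointTransform q Finset.univ j b s) := by
  change coeff D (deletePthPowers q (CentreBlowup.pointTransform q Finset.univ j b s)) = _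
  rw [coeff_deletePthPowers, if_neg (not_isPthPowerExponent_of_not_dvd hD)]

/-- The weight of an untranslated non-chart letter is kept by the step. [folklore] [cite: HauserPerlega2019PRIMS, §2 (transform D′ of D)] -/
theorem step_r_apply_of_ne_chart_of_untranslated (q : ℕ) (j : Fin 4) {b : Fin 4 → K} {s : State K} {o : ℕ} (ho : ordZero s.F = o) {z : Fin 4}
    (hzj : z ≠ j) (hbz : b z = 0) : (CentreBlowup.step q Finset.univ j b s).r z = s.r z := by
  rw [SwapTransport.step_r_apply_gen q ho j b z, if_neg hzj, if_pos hbz]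

/-- **THE SLICE OF THE CLEANED CHILD** (§1 combined): for `z ≠ j` untranslated and `q ∤ D_z`, `coeff_D (step q univ j b s).F` is the slice
Lucas sum of `coeff_pointTransform_slice`. [OURS] -/
theorem coeff_step_F_slice (q : ℕ) (j : Fin 4) (b : Fin 4 → K) (s : State K) {z : Fin 4} (hzj : z ≠ j) (hbz : b z = 0)
    {D : Fin 4 →₀ ℕ} (hD : ¬ q ∣ D z) :
    coeff D (CentreBlowup.step q Finset.univ j b s).F =
      ∑ E ∈ s.F.support with E z = D z, coeff E s.F *
        ∏ i ∈ Finset.univ.erase z, (((chartExponent q Finset.univ j E i).choose (D i) : K) *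
          b i ^ (chartExponent q Finset.univ j E i - D i)) := by
  rw [coeff_step_F_of_not_dvd q j b s hD, coeff_pointTransform_slice q j b s hzj hbz]

/-! ## §2 The bottom slice of a power-cone state -/

/-- **THE BOTTOM SLICE OF A POWER CONE IN DEGREE `o` IS `x^r · a · (ℓ|_{x_z := 0})^d`**: for a state of order `o` with residual cone `resForm = a·(Σ ℓ_i x_i)^d`, every degree-`o` exponent `E` of the slice `E_z = r_z` has
`coeff_E F = coeff_{E − r} (a · (Σ_i ℓ̃_i x_i)^d)` with `ℓ̃ = ℓ` off `z` and `ℓ̃_z = 0`. [OURS] [folklore] -/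
theorem coeff_bottomSlice_eq_coeff_killVar_pow {s : State K} {o d : ℕ} (ho : ordZero s.F = o) {a : K} {ℓ : Fin 4 → K}
    (hform : resForm s = C a * (∑ i, C (ℓ i) * X i) ^ d) {z : Fin 4} {E : Fin 4 →₀ ℕ} (hE : E.degree = o) (hrE : s.r ≤ E)
    (hEz : E z = s.r z) :
    coeff E s.F = coeff (E - s.r) (C a * (∑ i, C (Function.update ℓ z 0 i) * X i) ^ d) := by
  classical
  have hsplit : E = s.r + (E - s.r) := (add_tsub_cancel_of_le hrE).symm
  have hz0 : (E - s.r) z = 0 := by rw [Finsupp.tsub_apply, hEz, Nat.sub_self]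
  rw [← NarrowApolarity.coeff_initialForm_of_degree_eq ho hE]
  conv_lhs => rw [hsplit]
  rw [← coeff_resForm, hform]
  -- a `z`-free exponent reads the same coefficient after `x_z ↦ 0`
  have hkill : coeff (E - s.r) (C a * (∑ i, C (ℓ i) * X i) ^ d) =
      coeff (E - s.r) (PointBlowup.killVar z (C a * (∑ i, C (ℓ i) * X i) ^ d)) := by
    rw [coeff_killVar, if_pos hz0]
  rw [hkill, map_mul, map_pow, killVar_linearForm]
  congr 2
  rw [← MvPolynomial.algebraMap_eq]
  exact (PointBlowup.killVar z).commutes a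

/-- **THE CONTACT MONOMIAL OF THE BOTTOM SLICE**: with `ℓ_φ ≠ 0` for a letter `φ ≠ z` and `a ≠ 0`, the monomial `x^r · x_φ^d` (slice `r_z`,
degree `o`) has coefficient `a · ℓ_φ^d ≠ 0`; in particular the bottom slice `F_{r_z}` divided by its boundary has order EXACTLY `|r| − r_z + d`
and a power-cone initial form transversal to the `φ`-axis (p-8's (S2)). [OURS] [folklore] -/
theorem coeff_bottomSlice_contact_ne_zero {s : State K} {o d : ℕ} (ho : ordZero s.F = o) (hod : s.r.degree + d = o)
    {a : K} (ha : a ≠ 0) {ℓ : Fin 4 → K} {z φ : Fin 4}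
    (hφz : φ ≠ z) (hℓφ : ℓ φ ≠ 0) (hform : resForm s = C a * (∑ i, C (ℓ i) * X i) ^ d) :
    coeff (s.r + Finsupp.single φ d) s.F = a * ℓ φ ^ d ∧ coeff (s.r + Finsupp.single φ d) s.F ≠ 0 := by
  classical
  have hE : (s.r + Finsupp.single φ d).degree = o := by rw [map_add, Finsupp.degree_single]; exact hod
  have hEz : (s.r + Finsupp.single φ d) z = s.r z := by
    rw [Finsupp.add_apply, Finsupp.single_eq_of_ne hφz.symm, add_zero]
  have h := coeff_bottomSlice_eq_coeff_killVar_pow ho hform hE le_self_add hEz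
  rw [add_tsub_cancel_left, coeff_C_mul, coeff_single_pow_linearForm, Function.update_of_ne hφz] at h
  exact ⟨h, by rw [h]; exact mul_ne_zero ha (pow_ne_zero _ hℓφ)⟩

/-- **THE BOTTOM SLICE TRAVELS ALONE AND UNCLEANED** (§1 at the bottom slice `e = r_z ∈ [1, q − 1]`): the weight of `z` is kept, and every
`coeff_D` of the child with `D_z = r_z` is the slice Lucas sum over the parent's bottom slice — p-8's trivariate game
`G′ = σ_{j,b}(G) / x_j^{q − r_z}` read coefficientwise. [OURS · composition of §1] -/
theorem bottomSlice_step (q : ℕ) (j : Fin 4) {b : Fin 4 → K} (hbj : b j = 0) {s : State K} {o : ℕ} (ho : ordZero s.F = o)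
    {z : Fin 4} (hzj : z ≠ j) (hbz : b z = 0) (hm1 : 1 ≤ s.r z) (hmq : s.r z < q) :
    (CentreBlowup.step q Finset.univ j b s).r z = s.r z ∧
      ∀ D : Fin 4 →₀ ℕ, D z = s.r z →
        coeff D (CentreBlowup.step q Finset.univ j b s).F =
          ∑ E ∈ s.F.support with E z = D z, coeff E s.F *
            ∏ i ∈ Finset.univ.erase z, (((chartExponent q Finset.univ j E i).choose (D i) : K) *
              b i ^ (chartExponent q Finset.univ j E i - D i)) := by
  have _ := hbj
  refine ⟨step_r_apply_of_ne_chart_of_untranslated q j ho hzj hbz, fun D hD => coeff_step_F_slice q j b s hzj hbz ?_⟩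
  rw [hD]
  intro h
  have := Nat.le_of_dvd (by omega) h
  omega

end ResCone
end Summit.ResolutionOfSingularities.ResolutionOfSingularities.Theorems.PIDim4

end
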